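import Summits.FinalStateConjecture.FinalStateConjecture.Theorems.WeakCosmicCensorshipMGHD.Negative.TruncatedMinkowski
import Literature.Geometry.Lorentzian.OpensChartGeodesicODE
import Literature.Geometry.Lorentzian.MinkowskiGlobalHyperbolicity
import Literature.Geometry.Lorentzian.ExtensionProofs
import HarnessLib

/-!
# Open sub-developments `η|_U` of Minkowski space: straight geodesics, inextendibility of maximal ones,
# and THE MISSING FUTURE IS A FUTURE SET — support for the crux `ChannelsResolveTameDevelopmentsR`
# (K2R ≡ Φ, item `stmt-FinalStateConjecture-14075`, route PhotonSphereChannels), load-bearing analysis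
# on the certifiable (flat) model class, part 1

Every open connected `U ⊆ ℝ⁴` containing the slice `{x⁰ = 0}` in which the slice is still a Cauchy
hypersurface carries the vacuum Cauchy development `η|_U` of the trivial admissible datum (`subDev`, via
`VacuumCauchyDevelopment.restrict`); these are ALL the certifiable models of Φ's carrier (the tree
constructs no development of a non-trivial datum): `U = {-1 < x⁰ < 1}` is the slab of
`Negative/SlabMinkowski`, `U = {x⁰ < 1}` the future cut of `WeakCosmicCensorshipMGHD/Negative/TruncatedMinkowski`.
This file supplies the tools of the completeness analysis of the sequel `SubMinkowskiCompleteness`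
(complete `𝓘⁺` ⟺ `{x⁰ ≥ 0} ⊆ U`):

* `geodesic_affine` — geodesics of `η|_U` are straight: `γ(t) = γ(0) + t γ'(0)` on their (interval)
  domain (geodesic equations in the chart `U`, vanishing Christoffel map; O'Neill 1983, Ch. 3, Cor. 21);
* `false_of_line_mem_at_closure_point` — a MAXIMAL geodesic of `η|_U` cannot have the point
  `γ(0) + c γ'(0)` in `U` at a finite end `c ∈ closure dom ∖ dom` of its domain (glue the straight line
  near `c`: a proper geodesic extension; O'Neill 1983, Ch. 3, Example 25);
* `not_mem_of_spatial_lt` — **the missing future is a future set**: if `q ∉ U`, `q⁰ ≥ 0`, then the whole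
  open future cone `{x | ‖x̲ − q̲‖ < x⁰ − q⁰}` misses `U` (else the straight timelike line from `q` through
  such an `x`, cut to its connected piece inside `U`, is an endless timelike curve of `η|_U` —
  `OpensCausality.not_hasFutureEndpoint_connectedComponentIn` — never meeting the slice, contradicting the
  Cauchy property; Sbierski 2016, §3.1);
All results proved; no named facts.

## References

* B. O'Neill, *Semi-Riemannian geometry* (1983), Ch. 3, Cor. 21, Example 25, Prop. 24; Ch. 5, p. 145;
  Ch. 14, p. 402 and Def. 14.28.
* J. Sbierski, AHP 17 (2016), §3.1 (curve pieces in open sub-spacetimes).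
* S. W. Hawking, G. F. R. Ellis, *The large scale structure of space-time* (1973), §6.2 (endless curves).
-/

noncomputable section

open Bundle Set Function Filter TopologicalSpace Topology MeasureTheory Metric
open scoped Manifold ContDiff Topology ENNReal

set_option linter.dupNamespace false

namespace Summit.FinalStateConjecture.FinalStateConjecture.Theorems.ChannelsResolveTameDevelopmentsR.SubMinkowski

open Literature.Geometry.Lorentzian Literature.Geometry.Lorentzian.Minkowski
open Summit.FinalStateConjecture.FinalStateConjecture.Theorems.WeakCosmicCensorshipMGHD.Negative
  (mdifferentiableAt_sliceNormal dirE3 norm_dirE3)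

/-! ### The open sub-spacetime `η|_U` -/

/-- The metric `η|_U` of the open sub-spacetime `U ⊆ ℝ⁴` (typed over the model `𝓡 4`, so that the chart
calculus of `OpensChart*` applies verbatim). -/
abbrev subMetric (U : Opens E4) : LorentzianMetric (𝓡 4) ∞ U :=
  vacuumCauchyDevelopment.metric.restrict PseudoRiemannianMetric.contMDiff_restrict_holds U

/-- The time orientation `∂ₜ|_U` of the open sub-spacetime `U`. -/
abbrev subOrientation (U : Opens E4) : TimeOrientation (subMetric U) :=
  vacuumCauchyDevelopment.timeOrientation.restrict PseudoRiemannianMetric.contMDiff_restrict_holds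
    vacuumCauchyDevelopment.timeOrientation.contMDiff_restrict_holds U

/-- **The open sub-development `η|_U` of the trivial datum**: the restriction of
`Minkowski.vacuumCauchyDevelopment` to an open connected `U ⊇ {x⁰ = 0}` in which the slice is still a
Cauchy hypersurface (`VacuumCauchyDevelopment.restrict`). Every such development embeds into Minkowski
space; `U = {-1 < x⁰ < 1}` is the slab of `Negative/SlabMinkowski`, `U = {x⁰ < 1}` the future cut of
`WeakCosmicCensorshipMGHD/Negative/TruncatedMinkowski`. -/
def subDev (U : Opens E4) (hU : IsConnected (U : Set E4)) (hsl : ∀ y : slice, sliceEmbed y ∈ U)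
    (hC : (subMetric U).IsCauchyHypersurface (subOrientation U)
      (range (vacuumCauchyDevelopment.embedOpens U hsl))) :
    VacuumCauchyDevelopment trivialData :=
  vacuumCauchyDevelopment.restrict U hU hsl mdifferentiableAt_sliceNormal hC

section SubDevelopment

variable {U : Opens E4}

/-- The components of `η|_U` are the constant form `η` (by `rfl`). -/
@[simp] theorem subMetric_val (x : U) : (subMetric U).val x = bilin := rfl

/-- The orienting field of `∂ₜ|_U` is `∂ₜ` (by `rfl`). -/
@[simp] theorem subOrientation_vectorField (x : U) :
    (subOrientation U).vectorField x = E4.basisVector 0 := rfl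

/-- The Christoffel map of the constant components `η` vanishes on `U`. -/
theorem christoffel_eq_zero [(subMetric U).toPseudoRiemannianMetric.HasLeviCivita] (x : U) (Y X : E4) :
    OpensChart.christoffel (subMetric U).toPseudoRiemannianMetric (fun _ : E4 ↦ bilin) x Y X = 0 := by
  have hK : OpensChart.koszulForm (fun _ : E4 ↦ bilin) (x : E4) Y X = 0 := by
    ext Z
    simp [OpensChart.koszulForm_apply]
  rw [OpensChart.christoffel_apply, hK, smul_zero]
  exact map_zero _

/-- **Geodesics of `η|_U` are straight lines.** Along a geodesic `γ` of `η|_U` on an open interval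
`dom ∋ 0` the velocity is constant, `= v := γ'(0)`, and `γ(t) = γ(0) + t v` (geodesic equations in the
chart `U`, `OpensChart.hasDerivAt_of_isGeodesicOn`, with vanishing Christoffel map; O'Neill 1983, Ch. 3,
Cor. 21 and Example 25). -/
theorem geodesic_affine [(subMetric U).toPseudoRiemannianMetric.HasLeviCivita] {γ : ℝ → U}
    {dom : Set ℝ} (hgeo : IsGeodesicOn (subMetric U).toPseudoRiemannianMetric.leviCivita γ dom)
    (hopen : IsOpen dom) (hoc : dom.OrdConnected) (h0 : (0 : ℝ) ∈ dom) :
    ∃ v : E4, velocity 𝓘(ℝ, E4) γ 0 = v ∧ (∀ t ∈ dom, velocity 𝓘(ℝ, E4) γ t = v) ∧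
      ∀ t ∈ dom, (γ t : E4) = (γ 0 : E4) + t • v := by
  -- the geodesic equations in the chart: position' = velocity, velocity' = 0
  have hD : ∀ t' ∈ dom,
      HasDerivAt (fun s ↦ (γ s : E4)) (velocity 𝓘(ℝ, E4) γ t') t' ∧
        HasDerivAt (fun s ↦ (velocity 𝓘(ℝ, E4) γ s : E4)) 0 t' := by
    intro t' ht'
    have h2 := OpensChart.hasDerivAt_of_isGeodesicOn (g := (subMetric U).toPseudoRiemannianMetric)
      (G := fun _ : E4 ↦ bilin) (fun _ ↦ rfl) (fun _ ↦ differentiableAt_const _) hgeo ht'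
    rw [christoffel_eq_zero, neg_zero] at h2
    exact h2
  have hvel : ∀ t' ∈ dom, (velocity 𝓘(ℝ, E4) γ t' : E4) = velocity 𝓘(ℝ, E4) γ 0 := fun t' ht' ↦
    hopen.is_const_of_deriv_eq_zero hoc.isPreconnected
      (fun s hs ↦ (hD s hs).2.differentiableAt.differentiableWithinAt)
      (fun s hs ↦ (hD s hs).2.deriv) ht' h0
  refine ⟨velocity 𝓘(ℝ, E4) γ 0, rfl, hvel, fun t ht ↦ ?_⟩
  set v : E4 := (velocity 𝓘(ℝ, E4) γ 0 : E4) with hv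
  have hF : ∀ t' ∈ dom, HasDerivAt (fun s ↦ (γ s : E4) - s • v) 0 t' := by
    intro t' ht'
    have h1 := (hD t' ht').1
    rw [hvel t' ht'] at h1
    have h2 : HasDerivAt (fun s : ℝ ↦ s • v) v t' := by
      simpa using (hasDerivAt_id t').smul_const v
    have h3 := h1.sub h2
    rwa [sub_self] at h3
  have hconst := hopen.is_const_of_deriv_eq_zero hoc.isPreconnected
    (fun s hs ↦ (hF s hs).differentiableAt.differentiableWithinAt) (fun s hs ↦ (hF s hs).deriv) ht h0
  have : (γ t : E4) - t • v = (γ 0 : E4) := by simpa using hconst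
  rw [← this, sub_add_cancel]

/-- **A maximal geodesic of `η|_U` cannot be prolonged along its line inside `U`**: if `γ` is a
maximal geodesic on `dom ∋ 0` and `c` is a finite end of `dom` (`c ∈ closure dom`, `c ∉ dom`), then the
point `γ(0) + c γ'(0)` of its supporting line is NOT in `U`. Otherwise the line lies in `U` for
parameters near `c`, and gluing it to `γ` (which IS the line on `dom`, `geodesic_affine`) gives a geodesic
on the strictly larger open interval `dom ∪ (c − ε, c + ε)`, contradicting maximality. O'Neill 1983,
Ch. 3, Example 25. -/
theorem false_of_line_mem_at_closure_point [(subMetric U).toPseudoRiemannianMetric.HasLeviCivita]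
    {γ : ℝ → U} {dom : Set ℝ}
    (hmax : IsMaximalGeodesicOn (subMetric U).toPseudoRiemannianMetric.leviCivita γ dom)
    (h0 : (0 : ℝ) ∈ dom) {v : E4} (hv : velocity 𝓘(ℝ, E4) γ 0 = v)
    {c : ℝ} (hc : c ∈ closure dom) (hcn : c ∉ dom) (hcU : (γ 0 : E4) + c • v ∈ (U : Set E4)) :
    False := by
  classical
  obtain ⟨hopen, hoc, hgeo, hmaximal⟩ := hmax
  obtain ⟨v', hv', -, hline⟩ := geodesic_affine hgeo hopen hoc h0
  have hvv : v' = v := hv'.symm.trans hv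
  subst hvv
  set x₀ : E4 := (γ 0 : E4) with hx₀
  set ℓ : ℝ → E4 := fun t ↦ x₀ + t • v' with hℓ
  have hℓc : Continuous ℓ := continuous_const.add (continuous_id.smul continuous_const)
  have hℓd : ∀ t, HasDerivAt ℓ v' t := fun t ↦ by
    simpa [hℓ] using ((hasDerivAt_id t).smul_const v').const_add x₀
  -- the parameters whose line point lies in `U`
  set S : Set ℝ := ℓ ⁻¹' (U : Set E4) with hS
  have hSo : IsOpen S := U.isOpen.preimage hℓc
  have hdomS : dom ⊆ S := fun t ht ↦ by
    show ℓ t ∈ (U : Set E4)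
    have : ℓ t = (γ t : E4) := (hline t ht).symm
    rw [this]
    exact (γ t).2
  have hcS : c ∈ S := hcU
  obtain ⟨ε, hε, hball⟩ := Metric.mem_nhds_iff.1 (hSo.mem_nhds hcS)
  rw [Real.ball_eq_Ioo] at hball
  -- a point of `dom` in the ball
  obtain ⟨t₁, ht₁dom, ht₁⟩ : ∃ t₁ ∈ dom, dist c t₁ < ε := Metric.mem_closure_iff.1 hc ε hε
  have ht₁K : t₁ ∈ Ioo (c - ε) (c + ε) := by
    rw [Real.dist_eq, abs_lt] at ht₁
    exact ⟨by linarith, by linarith⟩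
  -- the enlarged parameter interval
  set s' : Set ℝ := dom ∪ Ioo (c - ε) (c + ε) with hs'
  have hs'o : IsOpen s' := hopen.union isOpen_Ioo
  have hs'oc : s'.OrdConnected :=
    isPreconnected_iff_ordConnected.1 (IsPreconnected.union t₁ ht₁dom ht₁K
      (isPreconnected_iff_ordConnected.2 hoc) (isPreconnected_iff_ordConnected.2 ordConnected_Ioo))
  have hs'S : s' ⊆ S := union_subset hdomS hball
  have hcs' : c ∈ s' := Or.inr ⟨by linarith, by linarith⟩
  -- the glued curve: the line, lifted to `U` where it lies in `U`
  set γ' : ℝ → U := fun t ↦ if h : ℓ t ∈ (U : Set E4) then ⟨ℓ t, h⟩ else γ 0 with hγ'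
  have hγ'val : ∀ t ∈ S, (γ' t : E4) = ℓ t := fun t ht ↦ by
    have hmem : ℓ t ∈ (U : Set E4) := ht
    show Subtype.val (if h : ℓ t ∈ (U : Set E4) then (⟨ℓ t, h⟩ : U) else γ 0) = ℓ t
    rw [dif_pos hmem]
  have hγ'ev : ∀ t ∈ s', (fun s ↦ (γ' s : E4)) =ᶠ[𝓝 t] ℓ := fun t ht ↦ by
    filter_upwards [hSo.mem_nhds (hs'S ht)] with s hs using hγ'val s hs
  -- it is a geodesic of `η|_U` on `s'`
  have hgeo' : IsGeodesicOn (subMetric U).toPseudoRiemannianMetric.leviCivita γ' s' :=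
    (OpensChart.isGeodesicOn_of_hasDerivAt (g := (subMetric U).toPseudoRiemannianMetric)
      (G := fun _ : E4 ↦ bilin) (fun _ ↦ rfl) (fun _ ↦ differentiableAt_const _) hs'o
      (c := fun t ↦ (γ' t : E4)) (c' := fun _ ↦ v') (c'' := fun _ ↦ 0) (fun _ ↦ rfl)
      (fun t ht ↦ (hℓd t).congr_of_eventuallyEq (hγ'ev t ht))
      (fun t _ ↦ hasDerivAt_const t v')
      (fun t _ ↦ by rw [christoffel_eq_zero, add_zero])).1
  -- it agrees with `γ` on `dom`
  have heq : EqOn γ γ' dom := fun t ht ↦ by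
    apply Subtype.ext
    rw [hγ'val t (hdomS ht)]
    exact hline t ht
  -- maximality: `s' = dom`, so `c ∈ dom`
  have := hmaximal γ' s' hs'o hs'oc subset_union_left hgeo' heq
  exact hcn (this ▸ hcs')

/-! ### The missing future is a future set -/

/-- **Straight timelike lines are future timelike curves of Minkowski space**: `t ↦ x + t w` with
`‖w̲‖ < w⁰`. O'Neill 1983, Ch. 5, p. 145. -/
theorem isFutureTimelikeCurveOn_line {x w : E4} (hw : ‖E4.spatial w‖ < w 0) (s : Set ℝ) :
    spacetime.metric.IsFutureTimelikeCurveOn spacetime.timeOrientation (fun t : ℝ ↦ x + t • w) s := by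
  intro t _
  have hw0 : 0 < w 0 := (norm_nonneg _).trans_lt hw
  have htl : bilin w w < 0 := by
    rw [C0Extension.bilin_self_eq]
    nlinarith [norm_nonneg (E4.spatial w)]
  have hwne : w ≠ 0 := fun h ↦ by rw [h] at hw0; simp at hw0
  have hγ : HasDerivAt (fun σ : ℝ ↦ x + σ • w) w t := by
    simpa using ((hasDerivAt_id t).smul_const w).const_add x
  have hmd : MDifferentiableAt 𝓘(ℝ, ℝ) 𝓘(ℝ, E4) (fun σ : ℝ ↦ x + σ • w) t :=
    mdifferentiableAt_iff_differentiableAt.mpr hγ.differentiableAt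
  have hvel : velocity 𝓘(ℝ, E4) (fun σ : ℝ ↦ x + σ • w) t = w := ModelSpace.velocity_line x w t
  refine ⟨hmd, ?_, ⟨?_, ?_⟩, ?_⟩
  · change bilin (velocity 𝓘(ℝ, E4) (fun σ : ℝ ↦ x + σ • w) t)
      (velocity 𝓘(ℝ, E4) (fun σ : ℝ ↦ x + σ • w) t) < 0
    rw [hvel]; exact htl
  · change bilin (velocity 𝓘(ℝ, E4) (fun σ : ℝ ↦ x + σ • w) t)
      (velocity 𝓘(ℝ, E4) (fun σ : ℝ ↦ x + σ • w) t) ≤ 0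
    rw [hvel]; exact htl.le
  · change velocity 𝓘(ℝ, E4) (fun σ : ℝ ↦ x + σ • w) t ≠ 0
    rw [hvel]; exact hwne
  · change bilin (E4.basisVector 0) (velocity 𝓘(ℝ, E4) (fun σ : ℝ ↦ x + σ • w) t) < 0
    rw [hvel, bilin_basisVector_zero_left]
    linarith

/-- A straight timelike line of Minkowski space is future endless (its time coordinate tends to
`+∞`). Hawking–Ellis 1973, §6.2. -/
theorem isFutureEndless_line {x w : E4} (hw : 0 < w 0) : IsFutureEndless (fun t : ℝ ↦ x + t • w) univ := by
  refine ⟨univ_nonempty, fun p hp ↦ ?_⟩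
  have h := (hasFutureEndpoint_iff_tendsto_atTop (subset_univ (Ici (0 : ℝ)))).1 hp
  have h0 : Tendsto (fun t : ℝ ↦ (x + t • w) 0) atTop (𝓝 (p 0)) :=
    ((EuclideanSpace.proj (0 : Fin 4)).continuous.tendsto p).comp h
  have h1 : Tendsto (fun t : ℝ ↦ (x + t • w) 0) atTop atTop := by
    have : (fun t : ℝ ↦ (x + t • w) 0) = fun t ↦ x 0 + t * w 0 := by
      funext t; simp
    rw [this]
    exact tendsto_atTop_add_const_left _ _ (tendsto_id.atTop_mul_const hw)
  exact not_tendsto_atTop_of_tendsto_nhds h0 h1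

/-- A straight timelike line of Minkowski space is past endless (its time coordinate tends to
`−∞`). Hawking–Ellis 1973, §6.2. -/
theorem isPastEndless_line {x w : E4} (hw : 0 < w 0) : IsPastEndless (fun t : ℝ ↦ x + t • w) univ := by
  refine ⟨univ_nonempty, fun p hp ↦ ?_⟩
  have h := (hasPastEndpoint_iff_tendsto_atBot (subset_univ (Iic (0 : ℝ)))).1 hp
  have h0 : Tendsto (fun t : ℝ ↦ (x + t • w) 0) atBot (𝓝 (p 0)) :=
    ((EuclideanSpace.proj (0 : Fin 4)).continuous.tendsto p).comp h
  have h1 : Tendsto (fun t : ℝ ↦ (x + t • w) 0) atBot atBot := by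
    have : (fun t : ℝ ↦ (x + t • w) 0) = fun t ↦ x 0 + t * w 0 := by
      funext t; simp
    rw [this]
    exact tendsto_atBot_add_const_left _ _ (tendsto_id.atBot_mul_const hw)
  exact not_tendsto_atBot_of_tendsto_nhds h0 h1

/-- **THE MISSING FUTURE OF A SUB-DEVELOPMENT IS A FUTURE SET.** Let the slice be a Cauchy hypersurface
of `η|_U` and let `q ∉ U` be a point on or above the slice (`q⁰ ≥ 0`). Then no point `x` of the open
future cone of `q` (`‖x̲ − q̲‖ < x⁰ − q⁰`) lies in `U`: the straight timelike line `t ↦ x + t(x − q)`,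
cut to its connected piece through `t = 0` inside `U`, would be an endless timelike curve of `η|_U`
(`OpensCausality.not_hasFutureEndpoint_connectedComponentIn` and its dual: the ambient line is endless
and the piece cannot end inside `U`) whose parameters stay `> −1` (`t = −1` is the missing point `q`),
hence whose time coordinate stays `> q⁰ ≥ 0`: it never meets the slice, contradicting the Cauchy
property. Sbierski 2016, §3.1; O'Neill 1983, Ch. 14, Def. 14.28. -/
theorem not_mem_of_spatial_lt {hsl : ∀ y : slice, sliceEmbed y ∈ U}
    (hC : (subMetric U).IsCauchyHypersurface (subOrientation U)
      (range (vacuumCauchyDevelopment.embedOpens U hsl)))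
    {q : E4} (hq : q ∉ (U : Set E4)) (hq0 : 0 ≤ q 0) {x : E4}
    (hx : ‖E4.spatial x - E4.spatial q‖ < x 0 - q 0) : x ∉ (U : Set E4) := by
  classical
  intro hxU
  set w : E4 := x - q with hw
  have hw0' : w 0 = x 0 - q 0 := by simp [hw]
  have hws : ‖E4.spatial w‖ < w 0 := by rw [hw0', hw, map_sub]; exact hx
  have hw0 : 0 < w 0 := (norm_nonneg _).trans_lt hws
  -- the straight timelike line through `x`, an endless timelike curve of Minkowski space
  set ℓ : ℝ → E4 := fun t ↦ x + t • w with hℓ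
  have hℓc : Continuous ℓ := continuous_const.add (continuous_id.smul continuous_const)
  have hℓtl : spacetime.metric.IsFutureTimelikeCurveOn spacetime.timeOrientation ℓ univ :=
    isFutureTimelikeCurveOn_line hws univ
  have hfe : IsFutureEndless ℓ univ := isFutureEndless_line hw0
  have hpe : IsPastEndless ℓ univ := isPastEndless_line hw0
  have hℓ0 : ℓ 0 ∈ (U : Set E4) := by simpa [hℓ] using hxU
  -- its connected piece through `t = 0` inside `U`, as a curve of `U`
  set J : Set ℝ := connectedComponentIn (univ ∩ ℓ ⁻¹' (U : Set E4)) 0 with hJ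
  have h0J : (0 : ℝ) ∈ J := mem_connectedComponentIn ⟨mem_univ _, hℓ0⟩
  have hJsub : J ⊆ univ ∩ ℓ ⁻¹' (U : Set E4) := connectedComponentIn_subset _ _
  have hJord : J.OrdConnected := isPreconnected_iff_ordConnected.1 isPreconnected_connectedComponentIn
  set δ : ℝ → U := fun t ↦ if h : ℓ t ∈ (U : Set E4) then ⟨ℓ t, h⟩ else ⟨x, hxU⟩ with hδ
  have hδval : ∀ t ∈ J, (δ t : E4) = ℓ t := fun t ht ↦ by
    have hmem : ℓ t ∈ (U : Set E4) := (hJsub ht).2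
    show Subtype.val (if h : ℓ t ∈ (U : Set E4) then (⟨ℓ t, h⟩ : U) else ⟨x, hxU⟩) = ℓ t
    rw [dif_pos hmem]
  have hδev : ∀ t ∈ J, (Subtype.val ∘ δ) =ᶠ[𝓝 t] ℓ := fun t ht ↦ by
    have hmem : ℓ ⁻¹' (U : Set E4) ∈ 𝓝 t := hℓc.continuousAt.preimage_mem_nhds (U.isOpen.mem_nhds (hJsub ht).2)
    filter_upwards [hmem] with t' ht'
    show Subtype.val (if h : ℓ t' ∈ (U : Set E4) then (⟨ℓ t', h⟩ : U) else ⟨x, hxU⟩) = ℓ t'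
    rw [dif_pos (show ℓ t' ∈ (U : Set E4) from ht')]
  -- `δ` is a future timelike curve of `η|_U` on `J`
  have hδt : (subMetric U).IsFutureTimelikeCurveOn (subOrientation U) δ J := by
    refine (LorentzianMetric.isFutureTimelikeCurveOn_restrict_iff _ _ _ _ _).2 fun t ht ↦ ?_
    obtain ⟨hd, h1, h2⟩ := hℓtl t (mem_univ t)
    have hveq : velocity 𝓘(ℝ, E4) (Subtype.val ∘ δ) t = velocity 𝓘(ℝ, E4) ℓ t :=
      DFunLike.congr_fun (hδev t ht).mfderiv_eq (1 : ℝ)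
    refine ⟨(hδev t ht).mdifferentiableAt_iff.2 hd, ?_, ?_⟩
    · change bilin (velocity 𝓘(ℝ, E4) (Subtype.val ∘ δ) t) (velocity 𝓘(ℝ, E4) (Subtype.val ∘ δ) t) < 0
      rw [hveq]
      exact h1
    · change (bilin (velocity 𝓘(ℝ, E4) (Subtype.val ∘ δ) t) (velocity 𝓘(ℝ, E4) (Subtype.val ∘ δ) t) ≤ 0 ∧
          velocity 𝓘(ℝ, E4) (Subtype.val ∘ δ) t ≠ 0) ∧
        bilin (E4.basisVector 0) (velocity 𝓘(ℝ, E4) (Subtype.val ∘ δ) t) < 0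
      rw [hveq]
      exact h2
  -- `δ` is endless in `U` on `J`
  have hδf : IsFutureEndless δ J := by
    refine ⟨⟨0, h0J⟩, fun p hp ↦ ?_⟩
    have h1 : HasFutureEndpoint (Subtype.val ∘ δ) J (p : E4) := hasFutureEndpoint_subtypeVal_comp_iff.2 hp
    have h2 : HasFutureEndpoint ℓ J (p : E4) := h1.congr fun t ↦ hδval t t.2
    exact not_hasFutureEndpoint_connectedComponentIn ordConnected_univ (fun t _ ↦ hℓc.continuousAt) hfe
      U.isOpen (mem_univ 0) hℓ0 p.2 h2
  have hδp : IsPastEndless δ J := by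
    refine ⟨⟨0, h0J⟩, fun p hp ↦ ?_⟩
    have h1 : HasPastEndpoint (Subtype.val ∘ δ) J (p : E4) := hasPastEndpoint_subtypeVal_comp_iff.2 hp
    have h2 : HasPastEndpoint ℓ J (p : E4) := h1.congr fun t ↦ hδval t t.2
    exact not_hasPastEndpoint_connectedComponentIn ordConnected_univ (fun t _ ↦ hℓc.continuousAt) hpe
      U.isOpen (mem_univ 0) hℓ0 p.2 h2
  -- the Cauchy property: `δ` meets the slice at some `t ∈ J` ...
  obtain ⟨t, ⟨htJ, y, hy⟩, -⟩ := hC δ J ⟨hJord, hδt, hδf, hδp⟩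
  -- ... but `t > -1` (the line point at `-1` is `q ∉ U`) ...
  have ht1 : -1 < t := by
    by_contra hle
    push Not at hle
    have hm : (-1 : ℝ) ∈ J := hJord.out htJ h0J ⟨hle, by norm_num⟩
    have hU1 : ℓ (-1) ∈ (U : Set E4) := (hJsub hm).2
    have hℓ1 : ℓ (-1) = q := by
      show x + (-1 : ℝ) • (x - q) = q
      rw [neg_one_smul, neg_sub, add_sub_cancel]
    exact hq (hℓ1 ▸ hU1)
  -- ... so its time coordinate is positive, not `0`
  have htime : 0 < ℓ t 0 := by
    have h1 : ℓ t 0 = x 0 + t * (x 0 - q 0) := by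
      show (x + t • (x - q)) 0 = x 0 + t * (x 0 - q 0)
      simp
    rw [h1]
    have h2 : 0 < x 0 - q 0 := by rw [← hw0']; exact hw0
    nlinarith
  have h0 : ℓ t 0 = 0 := by
    rw [← hδval t htJ, ← hy]
    show (sliceEmbed y) 0 = 0
    simp [sliceEmbed_apply]
  linarith

section Fields

variable {hU : IsConnected (U : Set E4)} {hsl : ∀ y : slice, sliceEmbed y ∈ U}
  {hC : (subMetric U).IsCauchyHypersurface (subOrientation U)
    (range (vacuumCauchyDevelopment.embedOpens U hsl))}

/-- The metric of the sub-development is `η|_U` (by `rfl`). -/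
theorem subDev_metric : (subDev U hU hsl hC).metric = subMetric U := rfl

/-- The time orientation of the sub-development is `∂ₜ|_U` (by `rfl`). -/
theorem subDev_timeOrientation : (subDev U hU hsl hC).timeOrientation = subOrientation U := rfl

/-- The embedding of the sub-development is the codomain-restricted slice embedding (by `rfl`). -/
theorem subDev_embed : (subDev U hU hsl hC).embed = vacuumCauchyDevelopment.embedOpens U hsl := rfl

/-- The normal of the sub-development is `∂ₜ` (by `rfl`). -/
theorem subDev_normal : (subDev U hU hsl hC).normal = fun y ↦ sliceNormal y := rfl

end Fields

end SubDevelopment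

end Summit.FinalStateConjecture.FinalStateConjecture.Theorems.ChannelsResolveTameDevelopmentsR.SubMinkowski

end
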